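import Literature.Combinatorics.AssociationSchemes.SliceFKN
import HarnessLib

/-!
# Almost low-degree Boolean functions on the slice: the Kindler–Safra theorem on the slice
# (Keller–Klein 2020) and the junta theorems for low-degree functions (Filmus–Ihringer 2019, Filmus 2023)

Sources followed (all held, statements page-confirmed):
* N. Keller, O. Klein, *A structure theorem for almost low-degree functions on the slice*, Israel J.
  Math. 240 (2020) 179–221 [KellerKlein2020] (held text `paper:arxiv-1901.08839` = arXiv:1901.08839),
  §1 (Theorems 1.2, 1.4, 1.7, 1.8, Lemma 1.5) and §2 (Def. 2.10: degree on the slice).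
* Y. Filmus, F. Ihringer, *Boolean constant degree functions on the slice are juntas*, Discrete Math.
  342 (2019) 111614 [FilmusIhringer2019] (held `paper:arxiv-1801.06338`), Thm. 1.1 and §2.
* Y. Filmus, *Junta threshold for low degree Boolean functions on the slice*, Electron. J. Combin.
  30(1) (2023) [Filmus2023] (held `paper:doi-10-37236-11115`), Thm. 1.
* G. Kindler, S. Safra, *Noise-resistant Boolean functions are juntas* (2002) [KindlerSafra2002], as
  quoted in [KellerKlein2020, Thm. 1.2].

VOCABULARY: that of `SliceFKN.lean` — points of `{0,1}ⁿ` are subsets `U : Finset (Fin n)`, the slice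
`C([n],ℓ)` is `slice n ℓ`, `IsBooleanOn`, the uniform-measure squared distance `distSq 𝒟 f g = E_𝒟[(f−g)²]`,
degree `HasDegreeLEOn 𝒟 k g` (agreement on `𝒟` with `Σ_{|T| ≤ k} v_T · AND_T`, `AND_T(x) = Π_{i∈T} x_i`;
this is [KellerKlein2020, Def. 2.10]: "the space of degree `≤ k` functions on the slice is
`L_k = span_{|T| ≤ k} {AND_T}`", which "coincides with that of Filmus", ibid. Claim 2.11), juntas
`IsJuntaOn`. TRANSLATION OF THE HYPOTHESIS `‖f^{>k}‖₂² ≤ ε`: `f^{>k} = f − proj_{L_k} f` for the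
expectation inner product [KellerKlein2020, Def. 2.10], so `‖f^{>k}‖₂² = min_{g ∈ L_k} ‖f − g‖₂²` and
`‖f^{>k}‖₂² ≤ ε` is EQUIVALENT to `∃ g ∈ L_k, ‖f − g‖₂² ≤ ε`, which is how it is typed
(`HasDegreeLEOn … k g ∧ distSq … f g ≤ ε`); on the cube `{0,1}ⁿ` with the uniform measure the same
holds for the Fourier weight `W^{>k}(f) = Σ_{|S|>k} f̂(S)²` [KellerKlein2020, §1.1]. Keller–Klein write the
slice as `C([n], pn)`, `0 < p ≤ 1/2`, `pn ∈ ℤ` [KellerKlein2020, §2 Notation and Assumption]; typed with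
`ℓ = pn`, `0 < ℓ`, `2ℓ ≤ n`, `p = ℓ/n`. Unprinted absolute constants are typed as one `C` (resp. `C, c`)
quantified outermost; real powers `p^{Ck}` are `Real.rpow`.

WHAT IS HERE — all NAMED FACTS (published theorems not proved here, D-0014), no proofs:
`KindlerSafra2002_thm` [KellerKlein2020, Thm. 1.2], `KellerKlein2020_thm14` (Kindler–Safra on the
slice, the main theorem), `KellerKlein2020_lemma15` (the two-cases norm lemma for almost low-degree
`ℤ`-valued functions), `KellerKlein2020_thm17` (sharp Kindler–Safra on the cube), `KellerKlein2020_thm18`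
(sharp version on the slice), `FilmusIhringer2019_thm11` (Boolean degree-`d` functions on `C([n],k)`,
`C^d ≤ k ≤ n − C^d`, are `γ(d)`-juntas, `γ(d)` = the hypercube optimum — typed as: every `m` that bounds
the hypercube case bounds the slice case), `Filmus2023_thm1` (the junta threshold `k ≥ 2d`, `n ≥ 2k`;
the converse half of Thm. 1 — non-juntas for `1 ≤ k < 2d` — is deliberately NOT typed here).
The degree-`1` case [FilmusIhringer2019, Thm. 1.2] is PROVED in `SliceFKN.lean`
(`SliceFKN.FilmusIhringer2019_thm12`).

Consumer: cell pnp-psdrank (summit PneNP): the "level-`k` saturation stability on the slice" input of the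
log-scale `r = 1` rung (`Literature.Combinatorics.Optimization.RectangleDecayBal`, MEMO-18 §2(g) of the
cell). Label: support / instrument; nothing here concerns psd rank or P vs NP. No instances/notation.
-/

noncomputable section

open Finset
open scoped BigOperators

namespace Literature.Combinatorics.AssociationSchemes

namespace SliceKindlerSafra

open SliceFKN (slice IsBooleanOn distSq HasDegreeLEOn IsJuntaOn)

/-! ### The Kindler–Safra theorem on the cube (as quoted by Keller–Klein) -/

/-- **The Kindler–Safra theorem** (uniform measure on `{0,1}ⁿ`), in the form printed as
[KellerKlein2020, Thm. 1.2]: "There exist constants `C, c > 0` such that the following holds. Let `f` be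
a Boolean function such that `W^{>k}(f) ≤ ε`, where `ε < c^k`. Then `f` is `(ε + 2^{Ck} ε^{1/4})`-close to a
Boolean-valued function depending on at most `C^k` coordinates of `x`." (`W^{>k}(f) ≤ ε` ⇔ some degree-`≤ k`
multilinear `g` has `‖f − g‖² ≤ ε`; "`ε`-close" = `Pr[f ≠ h] ≤ ε` = `distSq univ f h ≤ ε` for Boolean `f, h`.)
Source of the theorem: the 2002 manuscript of Kindler and Safra. NAMED FACT, not proved here.
[cite: KellerKlein2020, Thm. 1.2 (§1.1)] [cite: KindlerSafra2002, main theorem] -/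
def KindlerSafra2002_thm : Prop :=
  ∃ C c : ℝ, 0 < C ∧ 0 < c ∧ ∀ (n k : ℕ) (f g : Finset (Fin n) → ℝ) (ε : ℝ),
    IsBooleanOn univ f → HasDegreeLEOn univ k g → distSq univ f g ≤ ε → ε < c ^ k →
      ∃ (h : Finset (Fin n) → ℝ) (m : ℕ), IsBooleanOn univ h ∧ (m : ℝ) ≤ C ^ k ∧ IsJuntaOn univ m h ∧
        distSq univ f h ≤ ε + (2 : ℝ) ^ (C * k) * ε ^ ((1 : ℝ) / 4)

/-! ### Keller–Klein: the Kindler–Safra theorem on the slice -/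

/-- **Keller–Klein's Kindler–Safra theorem on the slice** [KellerKlein2020, Thm. 1.4, verbatim]: "There
exists a constant `C` such that the following holds. Let `0 < p ≤ 1/2`, and let `f : C([n],pn) → {0,1}`
satisfy `‖f^{>k}‖₂² ≤ ε ≤ p^{Ck}` (where the norm is taken with respect to the uniform measure on the
slice). Then `f` is `2ε`-close to a degree-`k` `{0,1}`-valued function `f̃` on the slice." Typed with
`ℓ = pn` (`0 < ℓ`, `2ℓ ≤ n`, `p = ℓ/n`) and `‖f^{>k}‖₂² ≤ ε` as "some `g` of degree `≤ k` on the slice has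
`‖f − g‖₂² ≤ ε`" (equivalent, see the module docstring). "Since, for `0 ≪ p ≪ 1`, degree-`k` functions on
the slice were shown in [FI18, FKMW18] to depend on `O(2^k)` coordinates, our theorem implies that `f`
essentially depends on `O(2^k)` coordinates" (ibid.; see `FilmusIhringer2019_thm11`, `Filmus2023_thm1`).
NAMED FACT, not proved here. [cite: KellerKlein2020, Thm. 1.4 (§1.2)] -/
def KellerKlein2020_thm14 : Prop :=
  ∃ C : ℝ, 0 < C ∧ ∀ (n ℓ k : ℕ) (f g : Finset (Fin n) → ℝ) (ε : ℝ),
    0 < ℓ → 2 * ℓ ≤ n → IsBooleanOn (slice n ℓ) f → HasDegreeLEOn (slice n ℓ) k g →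
    distSq (slice n ℓ) f g ≤ ε → ε ≤ ((ℓ : ℝ) / n) ^ (C * k) →
      ∃ f' : Finset (Fin n) → ℝ, IsBooleanOn (slice n ℓ) f' ∧ HasDegreeLEOn (slice n ℓ) k f' ∧
        distSq (slice n ℓ) f f' ≤ 2 * ε

/-- **The two-cases norm lemma** [KellerKlein2020, Lemma 1.5, verbatim]: "There exists a constant `C` such
that the following holds. Let `0 < p ≤ 1/2` and let `f : C([n],pn) → ℤ` and `k ∈ ℤ⁺` be such that
`‖f^{>k}‖₂² ≤ ε`. Then either `‖f‖₂² ≤ 2ε` or `‖f‖₂² > p^{Ck}`." ("any almost low-degree function from the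
slice to `ℤ` is either very close to the constant zero function, or attains non-zero values at a
significant portion of its inputs"; the slice counterpart of the heart of Kindler–Safra's argument.)
`‖f‖₂² = distSq … f 0`. NAMED FACT, not proved here. [cite: KellerKlein2020, Lemma 1.5 (§1.2)] -/
def KellerKlein2020_lemma15 : Prop :=
  ∃ C : ℝ, 0 < C ∧ ∀ (n ℓ k : ℕ) (f g : Finset (Fin n) → ℝ) (ε : ℝ),
    0 < ℓ → 2 * ℓ ≤ n → 1 ≤ k → (∀ U ∈ slice n ℓ, ∃ z : ℤ, f U = z) →
    HasDegreeLEOn (slice n ℓ) k g → distSq (slice n ℓ) f g ≤ ε →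
      distSq (slice n ℓ) f 0 ≤ 2 * ε ∨ ((ℓ : ℝ) / n) ^ (C * k) < distSq (slice n ℓ) f 0

/-! ### Keller–Klein: the sharpened Kindler–Safra theorems -/

/-- **Sharp Kindler–Safra theorem on the cube** [KellerKlein2020, Thm. 1.7, verbatim]: "There exists a
constant `C > 0` such that the following holds. Let `f : {0,1}ⁿ → {0,1}` have `W^{>k}(f) ≤ ε ≤ 2^{−Ck}`.
Then, there exists a degree-`k` function `g : {0,1}ⁿ → {0,1}` with
`Pr_x[f(x) ≠ g(x)] ≤ ε + ε² (2 ln(1/ε))^k / k!`." (Uniform measure; tight up to a factor `2^{O(k)}` in the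
lower-order term, ibid.) Typed with `0 < ε` explicit (for `ε = 0` the conclusion is the hypothesis).
NAMED FACT, not proved here. [cite: KellerKlein2020, Thm. 1.7 (§1.3)] -/
def KellerKlein2020_thm17 : Prop :=
  ∃ C : ℝ, 0 < C ∧ ∀ (n k : ℕ) (f g : Finset (Fin n) → ℝ) (ε : ℝ),
    IsBooleanOn univ f → HasDegreeLEOn univ k g → distSq univ f g ≤ ε → 0 < ε →
    ε ≤ (2 : ℝ) ^ (-(C * k)) →
      ∃ g' : Finset (Fin n) → ℝ, IsBooleanOn univ g' ∧ HasDegreeLEOn univ k g' ∧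
        distSq univ f g' ≤ ε + ε ^ 2 * (2 * Real.log (1 / ε)) ^ k / (k.factorial : ℝ)

/-- **Sharp Kindler–Safra theorem on the slice** [KellerKlein2020, Thm. 1.8, verbatim]: "There exists a
constant `C > 0` such that the following holds. Let `0 < p ≤ 1/2` and let `f : C([n],pn) → {0,1}` satisfy
`‖f^{>k}‖₂² ≤ ε ≤ p^{Ck}` (where the norm is taken with respect to the uniform measure on the slice). Then
`f` is `(ε + ε² (C log(1/p) log(1/ε))^{Ck})`-close to a degree-`k` `{0,1}`-valued function `f̃` on the
slice." Typed with `ℓ = pn`, `0 < ε` explicit. NAMED FACT, not proved here.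
[cite: KellerKlein2020, Thm. 1.8 (§1.3)] -/
def KellerKlein2020_thm18 : Prop :=
  ∃ C : ℝ, 0 < C ∧ ∀ (n ℓ k : ℕ) (f g : Finset (Fin n) → ℝ) (ε : ℝ),
    0 < ℓ → 2 * ℓ ≤ n → IsBooleanOn (slice n ℓ) f → HasDegreeLEOn (slice n ℓ) k g →
    distSq (slice n ℓ) f g ≤ ε → 0 < ε → ε ≤ ((ℓ : ℝ) / n) ^ (C * k) →
      ∃ f' : Finset (Fin n) → ℝ, IsBooleanOn (slice n ℓ) f' ∧ HasDegreeLEOn (slice n ℓ) k f' ∧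
        distSq (slice n ℓ) f f' ≤
          ε + ε ^ 2 * (C * Real.log (1 / ((ℓ : ℝ) / n)) * Real.log (1 / ε)) ^ (C * k)

/-! ### Low-degree Boolean functions on the slice are juntas -/

/-- **Filmus–Ihringer's junta theorem** [FilmusIhringer2019, Thm. 1.1, verbatim]: "There exists a constant
`C` such that the following holds. If `C^d ≤ k ≤ n − C^d` and `f : C([n],k) → {0,1}` has degree `d`, then
`f` depends on at most `γ(d)` coordinates", where `γ(d)` is "the optimal bound" in Nisan–Szegedy's
theorem: every Boolean degree-`d` function on `{0,1}ᴺ` depends on at most `γ(d) ≤ d·2^{d−1}` coordinates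
(ibid., first paragraph; "a degree `d` function is a function of degree at most `d`", §2). Typed without
naming `γ(d)`: EVERY `m` such that all Boolean degree-`d` functions on all hypercubes `{0,1}ᴺ` are
`m`-juntas (i.e. every `m ≥ γ(d)`) bounds the slice case as well — equivalent to the printed statement.
NAMED FACT, not proved here. [cite: FilmusIhringer2019, Thm. 1.1 (§1)] -/
def FilmusIhringer2019_thm11 : Prop :=
  ∃ C : ℝ, 0 < C ∧ ∀ (d m : ℕ),
    (∀ (N : ℕ) (F : Finset (Fin N) → ℝ),
        IsBooleanOn univ F → HasDegreeLEOn univ d F → IsJuntaOn univ m F) →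
      ∀ (n k : ℕ) (f : Finset (Fin n) → ℝ), C ^ d ≤ (k : ℝ) → (k : ℝ) + C ^ d ≤ n →
        IsBooleanOn (slice n k) f → HasDegreeLEOn (slice n k) d f → IsJuntaOn (slice n k) m f

/-- **Filmus' junta threshold** [Filmus2023, Thm. 1 (p. 2), first half verbatim]: "Let `d ≥ 1`. There
exists a constant `m(d)` such that the following holds. If `k ≥ 2d` then for any `n ≥ 2k`, every Boolean
degree `d` function on `C([n],k)` is an `m(d)`-junta." (The converse half — "if `1 ≤ k < 2d` then for every
`m` there exist `n ≥ 2k` and a Boolean degree `d` function on `C([n],k)` which is not an `m`-junta" — is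
NOT typed here.) NAMED FACT, not proved here. [cite: Filmus2023, Thm. 1 (p. 2)] -/
def Filmus2023_thm1 : Prop :=
  ∀ d : ℕ, 1 ≤ d → ∃ m : ℕ, ∀ (n k : ℕ) (f : Finset (Fin n) → ℝ), 2 * d ≤ k → 2 * k ≤ n →
    IsBooleanOn (slice n k) f → HasDegreeLEOn (slice n k) d f → IsJuntaOn (slice n k) m f

end SliceKindlerSafra

end Literature.Combinatorics.AssociationSchemes
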